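import Summits.QuantumFields.GaugeBoot.Certificates.SparseBound
import Summits.QuantumFields.GaugeBoot.Certificates.Support
import HarnessLib

/-!
# Sparse certificate replay, part 3: linear-combination ("reduced") PSD blocks (gauge-boot L4 support)

HONEST FRAMING (cell `pub-gaugeboot`): certified bounds on lattice expectations at stated coupling,
gauge group, dimension and torus size; NOT a mass gap, NOT a continuum limit, NOT a string tension;
NOT Yang–Mills-summit-bearing (barriers `FixedCouplingUltralocality`, `PerturbativeInvisibility`).

Sequel of `Certificates/SparseSupport.lean` and `Certificates/SparseBound.lean` (cell-side emitter
`gb_lean_emit` 0.8 "reduced", FANOUT-PLAN A27 / A126 (2)).  The 0.7 replays need every PSD block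
to be a pure class table (each entry ONE variable with coefficient `1`).  Symmetry-REDUCED certsdp
problems (route (R): block `k` is `Y_kᵀ M Y_k` for a raw Gram / reflection block `M`) have entries
that are INTEGER LINEAR COMBINATIONS `Σ c · y_w`, and many small blocks (e.g. 34 blocks of
dimension `≤ 18`).  This file supplies, generically and once:
* combinations `coef` (kernel side) / `evalComb` (real side) and `sum_mul_coef`;
* block entry tables `EB[k][i][j - i]` (upper-triangular storage) with symmetric access `ent`;
* the coefficient matrices `fzE` of ALL blocks padded to one common size `m` — so that
  `Sparse.objective_bound₂` applies with the constant index type `σ _ = Fin m` — and the blocks in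
  their own dimensions `redE` (what a lattice binding sees), related by `gramE_eq_padM` /
  `posSemidef_padM` (zero-padding preserves positive semidefiniteness);
* the all-blocks factor-row length check `lenCheckAll` for the Gram duals.
The sequel `Certificates/SparseReducedTrace.lean` carries the per-variable position lists, the
shape / cover / trace-table checks, the summed trace identity and the assembled bound
`objective_bound_red` (→ `objective_bound₂` → `JanssonChaykinKeil.lmiForm_bound`).
Every kernel-side quantity is a structural `List` recursion checked by `decide +kernel` over index
ranges, as in parts 1–2.  All `[folklore]`; nothing here is specific to lattice gauge theory.
-/

namespace Summit.QuantumFields.GaugeBoot.Certificates.Sparse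

open Matrix Finset Literature.Computation.Certificates
  Summit.QuantumFields.GaugeBoot.Certificates.Support

noncomputable section

/-! ## Linear combinations -/

/-- Sum of the coefficients of variable `v` in a combination `[(w, c), …]`. [folklore] -/
def coef : List (ℕ × ℤ) → ℕ → ℤ
  | [], _ => 0
  | (w, c) :: rest, v => (bif w == v then c else 0) + coef rest v

/-- A non-zero coefficient of `v` comes from a listed pair `(v, c)`. [folklore] -/
theorem exists_mem_of_coef_ne_zero {v : ℕ} :
    ∀ {L : List (ℕ × ℤ)}, coef L v ≠ 0 → ∃ c, (v, c) ∈ L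
  | [], h => absurd rfl h
  | (w, c) :: rest, h => by
      by_cases hw : w = v
      · exact ⟨c, by simp [hw]⟩
      · have hb : (w == v) = false := beq_eq_false_iff_ne.mpr hw
        have h' : coef rest v ≠ 0 := by simpa [coef, hb] using h
        obtain ⟨c', hc'⟩ := exists_mem_of_coef_ne_zero h'
        exact ⟨c', List.mem_cons_of_mem _ hc'⟩

/-- `Σ_{(w, c) ∈ L} c · y_w` for a real vector `y` indexed by `Fin nv` (indices `≥ nv` contribute
`0`). This is the entry of a reduced block seen by a lattice binding. [folklore] -/
def evalComb {nv : ℕ} (L : List (ℕ × ℤ)) (y : Fin nv → ℝ) : ℝ :=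
  (L.map fun p => if h : p.1 < nv then (p.2 : ℝ) * y ⟨p.1, h⟩ else 0).sum

/-- `evalComb` of the empty combination. [folklore] -/
@[simp] theorem evalComb_nil {nv : ℕ} (y : Fin nv → ℝ) : evalComb [] y = 0 := by
  simp [evalComb]

/-- `evalComb` of a `cons`. [folklore] -/
theorem evalComb_cons {nv : ℕ} (w : ℕ) (c : ℤ) (rest : List (ℕ × ℤ)) (y : Fin nv → ℝ) :
    evalComb ((w, c) :: rest) y =
      (if h : w < nv then (c : ℝ) * y ⟨w, h⟩ else 0) + evalComb rest y := by
  simp [evalComb]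

/-- **`Σ_v y_v · coef L v = evalComb L y`** (the linear form of a combination). [folklore] -/
theorem sum_mul_coef {nv : ℕ} (y : Fin nv → ℝ) : ∀ L : List (ℕ × ℤ),
    ∑ v : Fin nv, y v * ((coef L v.val : ℤ) : ℝ) = evalComb L y
  | [] => by simp [coef]
  | (w, c) :: rest => by
      rw [evalComb_cons, ← sum_mul_coef y rest]
      have hsplit : ∀ v : Fin nv, y v * ((coef ((w, c) :: rest) v.val : ℤ) : ℝ) =
          y v * (((bif w == v.val then c else 0 : ℤ)) : ℝ) + y v * ((coef rest v.val : ℤ) : ℝ) := by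
        intro v; simp only [coef]; push_cast; ring
      simp only [hsplit, Finset.sum_add_distrib]
      congr 1
      by_cases hw : w < nv
      · rw [dif_pos hw, Finset.sum_eq_single (⟨w, hw⟩ : Fin nv)]
        · simp [mul_comm]
        · intro v _ hv
          have hb : (w == v.val) = false := by
            rw [beq_eq_false_iff_ne]; intro h; exact hv (Fin.ext h.symm)
          simp [hb]
        · intro h; exact absurd (Finset.mem_univ _) h
      · rw [dif_neg hw]
        refine Finset.sum_eq_zero fun v _ => ?_
        have hb : (w == v.val) = false := by
          rw [beq_eq_false_iff_ne]; intro h; exact hw (h ▸ v.isLt)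
        simp [hb]

/-! ## Block entry tables (upper-triangular storage, symmetric access) -/

/-- `EB[k][i][j − i]` = the combination at entry `(i, j)`, `i ≤ j`, of block `k`. [folklore] -/
def entU (EB : List (List (List (List (ℕ × ℤ))))) (k i j : ℕ) : List (ℕ × ℤ) :=
  ((EB.getD k []).getD i []).getD (j - i) []

/-- Symmetric access: the combination at entry `(i, j)` of block `k`. [folklore] -/
def ent (EB : List (List (List (List (ℕ × ℤ))))) (k i j : ℕ) : List (ℕ × ℤ) :=
  if i ≤ j then entU EB k i j else entU EB k j i

/-- `F⁽ᵏ⁾_v`: the integer coefficient matrix of `y_v` in block `k`, padded to `m × m`. [folklore] -/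
def fzE (EB : List (List (List (List (ℕ × ℤ))))) (k m v : ℕ) : Matrix (Fin m) (Fin m) ℤ :=
  Matrix.of fun i j => coef (ent EB k i.val j.val) v

/-- Padded block `k` as a real matrix-valued linear form `Σ_v y_v F⁽ᵏ⁾_v`. [folklore] -/
def gramE (EB : List (List (List (List (ℕ × ℤ))))) (k m nv : ℕ) (y : Fin nv → ℝ) :
    Matrix (Fin m) (Fin m) ℝ :=
  ∑ v : Fin nv, y v • (fzE EB k m v.val).map (Int.cast : ℤ → ℝ)

/-- Entries of the padded block are the evaluated combinations. [folklore] -/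
theorem gramE_apply (EB : List (List (List (List (ℕ × ℤ))))) (k m nv : ℕ) (y : Fin nv → ℝ)
    (i j : Fin m) : gramE EB k m nv y i j = evalComb (ent EB k i.val j.val) y := by
  simp only [gramE, Matrix.sum_apply, Matrix.smul_apply, Matrix.map_apply, fzE, Matrix.of_apply,
    smul_eq_mul]
  exact sum_mul_coef y _

/-- **Block `k` in its own dimension `d`** (the object a lattice binding identifies with
`Y_kᵀ M(y) Y_k`): entry `(i, j)` is the combination `ent EB k i j` evaluated at `y`. [folklore] -/
def redE (EB : List (List (List (List (ℕ × ℤ))))) (k d nv : ℕ) (y : Fin nv → ℝ) :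
    Matrix (Fin d) (Fin d) ℝ :=
  Matrix.of fun i j => evalComb (ent EB k i.val j.val) y

/-- Entries of `redE`. [folklore] -/
theorem redE_apply (EB : List (List (List (List (ℕ × ℤ))))) (k d nv : ℕ) (y : Fin nv → ℝ)
    (i j : Fin d) : redE EB k d nv y i j = evalComb (ent EB k i.val j.val) y := rfl

/-! ## Zero-padding preserves positive semidefiniteness -/

/-- Index map of the padding: `i ↦ inl i` if `i < d`, else the zero block. [folklore] -/
def padIdx (m d : ℕ) (i : Fin m) : Fin d ⊕ Unit :=
  if h : i.val < d then Sum.inl ⟨i.val, h⟩ else Sum.inr ()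

/-- Zero-padding (or truncation) of a `d × d` real matrix to `m × m`. [folklore] -/
def padM (m : ℕ) {d : ℕ} (A : Matrix (Fin d) (Fin d) ℝ) : Matrix (Fin m) (Fin m) ℝ :=
  (fromBlocks A 0 0 (0 : Matrix Unit Unit ℝ)).submatrix (padIdx m d) (padIdx m d)

/-- Entries of the padding. [folklore] -/
theorem padM_apply (m : ℕ) {d : ℕ} (A : Matrix (Fin d) (Fin d) ℝ) (i j : Fin m) :
    padM m A i j = if h : i.val < d ∧ j.val < d then A ⟨i.val, h.1⟩ ⟨j.val, h.2⟩ else 0 := by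
  simp only [padM, Matrix.submatrix_apply, padIdx]
  by_cases hi : i.val < d <;> by_cases hj : j.val < d <;> simp [hi, hj]

/-- **Zero-padding preserves positive semidefiniteness.** [folklore] -/
theorem posSemidef_padM (m : ℕ) {d : ℕ} {A : Matrix (Fin d) (Fin d) ℝ} (hA : A.PosSemidef) :
    (padM m A).PosSemidef :=
  (posSemidef_fromBlocks_diag hA Matrix.PosSemidef.zero).submatrix _

/-- Dimension check: in blocks `k < nb`, every entry `(i, j)` with `i, j < m` outside the block's
own dimension `dimL[k]` carries the empty combination. [folklore] -/
def dimCheck (EB : List (List (List (List (ℕ × ℤ))))) (dimL : List ℕ) (m nb : ℕ) : Bool :=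
  natAll nb fun k => natAll m fun i => natAll m fun j =>
    (decide (i < dimL.getD k 0) && decide (j < dimL.getD k 0)) || (ent EB k i j).isEmpty

/-- **The padded block is the zero-padding of the block in its own dimension.** [folklore] -/
theorem gramE_eq_padM {EB : List (List (List (List (ℕ × ℤ))))} {dimL : List ℕ} {m nb : ℕ}
    (h : dimCheck EB dimL m nb = true) {k : ℕ} (hk : k < nb) (nv : ℕ) (y : Fin nv → ℝ) :
    gramE EB k m nv y = padM m (redE EB k (dimL.getD k 0) nv y) := by
  ext i j
  rw [gramE_apply, padM_apply]
  by_cases hij : i.val < dimL.getD k 0 ∧ j.val < dimL.getD k 0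
  · rw [dif_pos hij, redE_apply]
  · rw [dif_neg hij]
    have hc := natAll_iff.mp (natAll_iff.mp (natAll_iff.mp h k hk) i.val i.isLt) j.val j.isLt
    simp only [Bool.or_eq_true, Bool.and_eq_true, decide_eq_true_eq] at hc
    rcases hc with hc | hc
    · exact absurd hc hij
    · rw [List.isEmpty_iff] at hc
      rw [hc, evalComb_nil]

/-- PSD of the block in its own dimension gives PSD of the padded block. [folklore] -/
theorem posSemidef_gramE_of_redE {EB : List (List (List (List (ℕ × ℤ))))} {dimL : List ℕ}
    {m nb : ℕ} (h : dimCheck EB dimL m nb = true) {k : ℕ} (hk : k < nb) {nv : ℕ}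
    {y : Fin nv → ℝ} (hpsd : (redE EB k (dimL.getD k 0) nv y).PosSemidef) :
    (gramE EB k m nv y).PosSemidef := by
  rw [gramE_eq_padM h hk]; exact posSemidef_padM m hpsd

/-! ## Gram duals of all blocks -/

/-- Every factor row of every block `k < nb` has length `≤ m`. [folklore] -/
def lenCheckAll (GB : List (List (List ℤ))) (m nb : ℕ) : Bool :=
  natAll nb fun k => lenCheck (GB.getD k []) m

/-- Soundness of `lenCheckAll`. [folklore] -/
theorem lenCheck_of_all {GB : List (List (List ℤ))} {m nb : ℕ} (h : lenCheckAll GB m nb = true)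
    (k : Fin nb) : lenCheck (GB.getD k.val []) m = true :=
  natAll_iff.mp h k.val k.isLt

end

end Summit.QuantumFields.GaugeBoot.Certificates.Sparse
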